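import Literature.AlgebraicGeometry.Resolution.GeneralizedStabilityHolds
import Literature.AlgebraicGeometry.Resolution.KnafKuhlmann2005Thm34Stability
import Literature.AlgebraicGeometry.Resolution.AbhyankarConstantReduction
import HarnessLib

/-!
# `α_p`-torsors along Abhyankar places: the base field `Frac A₀` is defectless in `K`

Crux `Valuative.LuAlphaPTorsor` (item `stmt-ResolutionOfSingularities-0641`), line
`pfaff-line-log-final-forms`, registered helper `isDefectlessIn_torsor_of_isAbhyankarPlace`
(toward the dimension-two Abhyankar corollary).

Setting: `k` a field of characteristic `p`, `K ⊇ k` a field, `O` a valuation ring of `K`,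
`A₀ ⊆ O` a finitely generated `k`-subalgebra, `t ∈ K` with `t ^ p ∈ A₀` and `Frac (A₀[t]) = K`;
`K₀ := k(A₀) = Frac A₀` as an intermediate field of `K/k`, valued by `O ∩ K₀`.

**Claim.** If `O` is an Abhyankar place of `K/k` (`IsAbhyankarPlace O (im k) ⊤`, equality in
Abhyankar's inequality), then `(K₀, O ∩ K₀)` is defectless in the finite extension `K`
(`IsDefectlessIn`).

Proof. (1) `K^p ⊆ K₀` (Frobenius: `A₀[t]^p ⊆ A₀`), so `K/K₀` is finite (`K = K₀(t)`, `t`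
integral) and purely inseparable of exponent one. (2) The Abhyankar data of `O` over `k`
(`x` with `ℤ`-independent values, `y ∈ O` with residues algebraically independent over `k`,
`(x, y)` a transcendence basis of `K/k` — read off `IsAbhyankarPlace` through Knaf–Kuhlmann 2005,
Thm. 2.1) has `p`-th powers `(x^p, y^p)` INSIDE `K₀` with the same properties, and `(x^p, y^p)` is
still a transcendence basis of `K/k` (same cardinality), so `K₀` is algebraic over `k(x^p, y^p)`:
the transcendence defect of `(K₀, O ∩ K₀)` over `k` vanishes
(`transcendenceDefect_eq_zero_of_isAlgebraic`). (3) `K₀/k` is finitely generated, so Kuhlmann's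
generalized stability theorem (`Kuhlmann2010Stability_holds`, PROVED in the tree) makes
`(K₀, O ∩ K₀)` a defectless field; apply it to the finite extension `K`.
-/

-- single-problem summit: the doubled namespace component `ResolutionOfSingularities` is forced
set_option linter.dupNamespace false

namespace Summit.ResolutionOfSingularities.ResolutionOfSingularities.Theorems.PfaffLine

open IsLocalRing Literature.AlgebraicGeometry.Resolution

/-! ### Field-theoretic preliminaries on `K₀ = k(A₀) ⊆ K = Frac (A₀[t])`, `t ^ p ∈ A₀` -/

/-- **`K^p ⊆ k(A₀)`**: in characteristic `p`, if `t ^ p ∈ A₀` and `K = Frac (A₀[t])`, then the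
`p`-th power of every element of `K` lies in `K₀ = k(A₀)` (Frobenius maps `A₀[t]` into `A₀`).
[folklore] -/
theorem torsor_pow_mem_adjoin {k K : Type} [Field k] [Field K] [Algebra k K]
    {p : ℕ} (hp : p.Prime) [CharP K p] (A₀ : Subalgebra k K) (t : K) (ht : t ^ p ∈ A₀)
    (hfr : IsFractionRing (Algebra.adjoin k (insert t (A₀ : Set K))) K) (z : K) :
    z ^ p ∈ IntermediateField.adjoin k (A₀ : Set K) := by
  haveI : Fact p.Prime := ⟨hp⟩
  set K₀ := IntermediateField.adjoin k (A₀ : Set K)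
  set R := Algebra.adjoin k (insert t (A₀ : Set K))
  -- every element of `R = A₀[t]` has its `p`-th power in `K₀`
  have hR : ∀ a ∈ R, a ^ p ∈ K₀ := by
    intro a ha
    refine Algebra.adjoin_induction (fun s hs => ?_) (fun c => ?_) (fun a b _ _ ha hb => ?_)
      (fun a b _ _ ha hb => ?_) ha
    · rcases Set.mem_insert_iff.mp hs with rfl | hs
      · exact IntermediateField.subset_adjoin k _ ht
      · exact IntermediateField.subset_adjoin k _ (A₀.pow_mem hs p)
    · rw [← map_pow]
      exact K₀.algebraMap_mem _
    · rw [add_pow_char]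
      exact add_mem ha hb
    · rw [mul_pow]
      exact mul_mem ha hb
  haveI := hfr
  obtain ⟨a, b, -, rfl⟩ := IsFractionRing.div_surjective (A := R) z
  rw [div_pow]
  exact div_mem (hR _ a.2) (hR _ b.2)

/-- **`K` is finite over `K₀ = k(A₀)`**: `K = K₀(t)` with `t` integral over `K₀` (`t ^ p ∈ A₀`,
`p ≠ 0`). [folklore] -/
theorem torsor_finiteDimensional_adjoin {k K : Type} [Field k] [Field K] [Algebra k K]
    {p : ℕ} (hp : 0 < p) (A₀ : Subalgebra k K) (t : K) (ht : t ^ p ∈ A₀)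
    (hfr : IsFractionRing (Algebra.adjoin k (insert t (A₀ : Set K))) K) :
    FiniteDimensional (IntermediateField.adjoin k (A₀ : Set K)) K := by
  set K₀ := IntermediateField.adjoin k (A₀ : Set K)
  -- `t` is integral over `K₀`
  have htp : t ^ p ∈ K₀ := IntermediateField.subset_adjoin k _ ht
  have htint : IsIntegral K₀ t := by
    have h : IsIntegral K₀ (algebraMap K₀ K ⟨t ^ p, htp⟩) := isIntegral_algebraMap
    exact IsIntegral.of_pow hp h
  -- `K = K₀(t)`
  have htop : IntermediateField.adjoin K₀ ({t} : Set K) = ⊤ := by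
    rw [eq_top_iff]
    intro z _
    haveI := hfr
    obtain ⟨a, b, -, rfl⟩ :=
      IsFractionRing.div_surjective (A := Algebra.adjoin k (insert t (A₀ : Set K))) z
    have hR : Algebra.adjoin k (insert t (A₀ : Set K)) ≤
        (IntermediateField.adjoin K₀ ({t} : Set K)).toSubalgebra.restrictScalars k := by
      rw [Algebra.adjoin_le_iff]
      intro s hs
      rcases Set.mem_insert_iff.mp hs with rfl | hs
      · exact IntermediateField.subset_adjoin K₀ _ (Set.mem_singleton s)
      · exact (IntermediateField.adjoin K₀ ({t} : Set K)).algebraMap_mem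
          ⟨s, IntermediateField.subset_adjoin k _ hs⟩
    exact div_mem (hR a.2) (hR b.2)
  haveI : FiniteDimensional K₀ (IntermediateField.adjoin K₀ ({t} : Set K)) :=
    IntermediateField.adjoin.finiteDimensional htint
  rw [htop] at this
  exact LinearEquiv.finiteDimensional
    (IntermediateField.topEquiv (F := K₀) (E := K)).toLinearEquiv

/-- **`K₀ = k(A₀)` is finitely generated over `k`** (by the finitely many algebra generators of
`A₀`). [folklore] -/
theorem fg_top_adjoin_of_fg {k K : Type} [Field k] [Field K] [Algebra k K]
    (A₀ : Subalgebra k K) (hfg : A₀.FG) :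
    (⊤ : IntermediateField k (IntermediateField.adjoin k (A₀ : Set K))).FG := by
  classical
  obtain ⟨s, hs⟩ := hfg
  set K₀ := IntermediateField.adjoin k (A₀ : Set K) with hK₀def
  have hK₀ : K₀ = IntermediateField.adjoin k (s : Set K) := by
    apply le_antisymm
    · rw [hK₀def, IntermediateField.adjoin_le_iff, ← hs]
      exact fun z hz => IntermediateField.algebra_adjoin_le_adjoin k _ hz
    · exact IntermediateField.adjoin.mono k _ _ (hs ▸ Algebra.subset_adjoin)
  have hsK₀ : ∀ z ∈ s, z ∈ K₀ := by
    intro z hz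
    rw [hK₀]
    exact IntermediateField.subset_adjoin k _ hz
  let s₀ : Set K₀ := Subtype.val ⁻¹' (s : Set K)
  have hs₀ : s₀.Finite := s.finite_toSet.preimage Subtype.val_injective.injOn
  refine IntermediateField.fg_def.mpr ⟨s₀, hs₀, ?_⟩
  apply IntermediateField.lift_injective K₀
  rw [IntermediateField.lift_adjoin, IntermediateField.lift_top]
  have himage : Subtype.val '' s₀ = (s : Set K) := by
    rw [Set.image_preimage_eq_iff]
    intro z hz
    exact ⟨⟨z, hsK₀ z hz⟩, rfl⟩
  rw [himage, ← hK₀]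

/-! ### Abhyankar data in the type rendering, and their `p`-th powers -/

-- adapted from Literature/AlgebraicGeometry/Resolution/KnafKuhlmann2005Thm34Stability.lean
-- (`isAlgebraic_adjoin_intermediateField`, there over a subfield of the ambient field)
/-- Algebraicity over `k(b)` computed in `K` gives algebraicity over `k(b)` computed in an
intermediate field `M ∋ bᵢ`. [folklore] -/
theorem isAlgebraic_adjoin_of_coe {k K : Type} [Field k] [Field K] [Algebra k K]
    (M : IntermediateField k K) {ι : Type} (b : ι → M) {m : M}
    (h : IsAlgebraic (IntermediateField.adjoin k (Set.range fun i => (b i : K))) (m : K)) :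
    IsAlgebraic (IntermediateField.adjoin k (Set.range b)) m := by
  set A := IntermediateField.adjoin k (Set.range b) with hA
  have himage : Subtype.val '' Set.range b = Set.range fun i => (b i : K) := by
    rw [← Set.range_comp]
    rfl
  have hlift : IntermediateField.lift A =
      IntermediateField.adjoin k (Set.range fun i => (b i : K)) := by
    rw [hA, IntermediateField.lift_adjoin, himage]
  let f : A →+* IntermediateField.adjoin k (Set.range fun i => (b i : K)) :=
    { toFun := fun w => ⟨((w : M) : K), by
        rw [← hlift]; exact (IntermediateField.mem_lift (w : M)).mpr w.2⟩
      map_one' := rfl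
      map_mul' := fun _ _ => rfl
      map_zero' := rfl
      map_add' := fun _ _ => rfl }
  have hf : Function.Surjective f := by
    intro w
    have hw : (w : K) ∈ IntermediateField.lift A := by rw [hlift]; exact w.2
    exact ⟨⟨⟨w, IntermediateField.lift_le A hw⟩, (IntermediateField.mem_lift _).mp hw⟩,
      Subtype.ext rfl⟩
  exact IsAlgebraic.of_ringHom_of_comp_eq f (algebraMap M K) h hf (algebraMap M K).injective
    (RingHom.ext fun _ => rfl)

/-- **Abhyankar data of an Abhyankar place, type rendering** (Knaf–Kuhlmann 2005, Thm. 2.1): if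
`O ⊇ k` is an Abhyankar place of `K/k` in the ambient rendering `IsAbhyankarPlace O (im k) ⊤`,
then there are non-zero `x : Fin ρ → K` with `ℤ`-independent values and `y : Fin τ → O` with
residues algebraically independent over `k` such that `(x, y)` is a transcendence basis of
`K/k`. [cite: KnafKuhlmann2005, Thm. 2.1] -/
theorem exists_abhyankarData_of_isAbhyankarPlace {k K : Type} [Field k] [Field K] [Algebra k K]
    (O : ValuationSubring K) (hk : ∀ c : k, algebraMap k K c ∈ O)
    (hA : IsAbhyankarPlace O (algebraMap k K).fieldRange ⊤) :
    ∃ (ρ τ : ℕ) (x : Fin ρ → K) (y : Fin τ → O), IsValueIndependent O x ∧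
      (letI := algebraOfMem k O hk; AlgebraicIndependent k fun j => residue O (y j)) ∧
      IsTranscendenceBasis k (Sum.elim x fun j => (y j : K)) := by
  classical
  obtain ⟨ρ, τ, x, y, hy, hx, -, hxi, hri, halg⟩ := hA
  set kK : Subfield K := (algebraMap k K).fieldRange with hkK
  have hx0 : ∀ i, x i ≠ 0 := fun i => (hx i).2
  have hxv : IsValueIndependent O x := isValueIndependent_of_valIndep O kK hx0 hxi
  let y' : Fin τ → O := fun j => ⟨y j, hy j⟩
  letI := algebraOfMem k O hk
  haveI := isScalarTower_algebraOfMem k O hk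
  -- base change of the residues from `resField O (im k)` to `k`
  have hyk : AlgebraicIndependent k fun j => residue O (y' j) := by
    have hkKO : ∀ z ∈ kK, z ∈ O := by
      intro z hz
      obtain ⟨c, rfl⟩ := RingHom.mem_fieldRange.mp hz
      exact hk c
    obtain ⟨φ, -, -, hφ, -⟩ := exists_residue_ringHoms O kK (F := kK) le_rfl hkKO
    let φ' : k →+* resField O kK := φ.comp (algebraMap k K).rangeRestrictField
    refine AlgebraicIndependent.of_ringHom_of_comp_eq φ' (RingHom.id (ResidueField O))
      (by simpa using hri) φ'.injective ?_
    ext c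
    change ((φ ((algebraMap k K).rangeRestrictField c) : ResidueField O)) =
      residue O ⟨algebraMap k K c, hk c⟩
    rw [hφ]
    rfl
  -- `K` is algebraic over `k(x, y)`: the two renderings of `k(x, y)` have the same elements
  have hset : Set.range (Sum.elim x fun j => (y' j : K)) = Set.range x ∪ Set.range y := by
    rw [Set.Sum.elim_range]
  have hrange : Set.range (algebraMap kK K) = Set.range (algebraMap k K) := by
    ext z
    simp only [Set.mem_range]
    constructor
    · rintro ⟨c, rfl⟩
      obtain ⟨w, hw⟩ := RingHom.mem_fieldRange.mp c.2
      exact ⟨w, hw⟩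
    · rintro ⟨w, rfl⟩
      exact ⟨⟨algebraMap k K w, RingHom.mem_fieldRange.mpr ⟨w, rfl⟩⟩, rfl⟩
  have hTT' : ∀ z : K, z ∈ IntermediateField.adjoin k (Set.range (Sum.elim x fun j => (y' j : K))) ↔
      z ∈ IntermediateField.adjoin kK (Set.range x ∪ Set.range y) := by
    intro z
    rw [← IntermediateField.mem_toSubfield, ← IntermediateField.mem_toSubfield,
      IntermediateField.adjoin_toSubfield, IntermediateField.adjoin_toSubfield, hset, hrange]
  have halgk : Algebra.IsAlgebraic
      (IntermediateField.adjoin k (Set.range (Sum.elim x fun j => (y' j : K)))) K := by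
    refine ⟨fun z => ?_⟩
    let f : IntermediateField.adjoin k (Set.range (Sum.elim x fun j => (y' j : K))) →+*
        IntermediateField.adjoin kK (Set.range x ∪ Set.range y) :=
      { toFun := fun w => ⟨w, (hTT' _).mp w.2⟩
        map_one' := rfl
        map_mul' := fun _ _ => rfl
        map_zero' := rfl
        map_add' := fun _ _ => rfl }
    have hf : Function.Surjective f := fun w => ⟨⟨w, (hTT' _).mpr w.2⟩, rfl⟩
    exact IsAlgebraic.of_ringHom_of_comp_eq f (RingHom.id K) (halg z (Subfield.mem_top z)) hf
      (RingHom.id K).injective (RingHom.ext fun _ => rfl)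
  have hind : AlgebraicIndependent k (Sum.elim x fun j => (y' j : K)) :=
    algebraicIndependent_sumElim_of_valuation O y' hyk x hxv.injective_prod_pow
  exact ⟨ρ, τ, x, y', hxv, hyk, hind.isTranscendenceBasis_iff_isAlgebraic.mpr
    (IntermediateField.isAlgebraic_adjoin_iff_top.mp halgk)⟩

/-- **`D = 0` for the restriction of an Abhyankar place to a subfield containing all `p`-th
powers.** If `O ⊇ k` is an Abhyankar place of `K/k` and `K₀` is an intermediate field with
`K^p ⊆ K₀` (`0 < p`), then the transcendence defect of `(K₀, O ∩ K₀)` over `k` vanishes: the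
`p`-th powers of Abhyankar data `(x, y)` of `K` lie in `K₀`, keep `ℤ`-independent values and
algebraically independent residues, and still form a transcendence basis of `K/k`, over whose
field `K₀` is therefore algebraic. [folklore] -/
theorem transcendenceDefect_comap_eq_zero_of_pow_mem {k K : Type} [Field k] [Field K]
    [Algebra k K] (O : ValuationSubring K) (hk : ∀ c : k, algebraMap k K c ∈ O) {p : ℕ}
    (hp : 0 < p) (K₀ : IntermediateField k K) (hKp : ∀ z : K, z ^ p ∈ K₀)
    (hk₀ : ∀ c : k, algebraMap k K₀ c ∈ O.comap (algebraMap K₀ K))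
    (hA : IsAbhyankarPlace O (algebraMap k K).fieldRange ⊤) :
    transcendenceDefect k (O.comap (algebraMap K₀ K)) hk₀ = 0 := by
  classical
  obtain ⟨ρ, τ, x, y, hxv, hyk, hB⟩ := exists_abhyankarData_of_isAbhyankarPlace O hk hA
  set O' := O.comap (algebraMap K₀ K) with hO'
  letI := algebraOfMem k O hk
  haveI := isScalarTower_algebraOfMem k O hk
  -- the `p`-th powers, inside `K₀`
  let x₁ : Fin ρ → K₀ := fun i => ⟨x i ^ p, hKp _⟩
  let y₁ : Fin τ → O' := fun j =>
    ⟨⟨(y j : K) ^ p, hKp _⟩, ValuationSubring.mem_comap.mpr (O.pow_mem (y j).2 p)⟩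
  have hx0 : ∀ i, x i ≠ 0 := hxv.1
  have hx0₁ : ∀ i, x₁ i ≠ 0 := fun i h => pow_ne_zero p (hx0 i) (congrArg Subtype.val h)
  -- values of `p`-th powers stay `ℤ`-independent
  have hxv₁ : IsValueIndependent O' x₁ := by
    rw [hO', isValueIndependent_comap_iff]
    refine ⟨fun i => pow_ne_zero p (hx0 i), fun s g hsg j hj => ?_⟩
    have hprod : (∏ j ∈ s, x j ^ ((p : ℤ) * g j)) = ∏ j ∈ s, (algebraMap K₀ K (x₁ j)) ^ g j :=
      Finset.prod_congr rfl fun j _ => by rw [zpow_mul, zpow_natCast]; rfl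
    have h := hxv.2 s (fun j => (p : ℤ) * g j) (by rw [hprod]; exact hsg) j hj
    exact (mul_eq_zero.mp h).resolve_left (by exact_mod_cast hp.ne')
  have hx₁ := (isValueIndependent_iff_linearIndependent O' x₁ hx0₁).mp hxv₁
  -- residues of `p`-th powers stay algebraically independent over `k`
  have hyp : AlgebraicIndependent k fun j => residue O (y j) ^ p := by
    have h := hyk.polynomial_aeval_of_transcendental (f := fun _ => Polynomial.X ^ p)
      (fun _ => (Polynomial.transcendental_X k).pow hp)
    simpa using h
  letI := algebraOfMem k O' hk₀
  have hy₁ : AlgebraicIndependent k fun j => residue O' (y₁ j) := by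
    refine AlgebraicIndependent.of_comp (residueFieldComapAlgHom k O hk hk₀) ?_
    have hcomp : ⇑(residueFieldComapAlgHom k O hk hk₀) ∘ (fun j => residue O' (y₁ j)) =
        fun j => residue O (y j) ^ p := by
      funext j
      simp only [Function.comp_apply]
      rw [residueFieldComapAlgHom_residue, ← map_pow]
      congr 1
    rw [hcomp]
    exact hyp
  -- `(x^p, y^p)` is still a transcendence basis of `K/k`
  have hBp : IsTranscendenceBasis k fun i => (Sum.elim x (fun j => (y j : K)) i) ^ p := by
    have hind : AlgebraicIndependent k fun i => (Sum.elim x (fun j => (y j : K)) i) ^ p := by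
      have h := hB.1.polynomial_aeval_of_transcendental (f := fun _ => Polynomial.X ^ p)
        (fun _ => (Polynomial.transcendental_X k).pow hp)
      simpa using h
    exact hind.isTranscendenceBasis_of_lift_trdeg_le_of_finite hB.lift_cardinalMk_eq_trdeg.ge
  -- hence `K₀` is algebraic over `k(x^p, y^p)`
  have hgen : Algebra.IsAlgebraic
      (IntermediateField.adjoin k (Set.range (Sum.elim x₁ fun j => (y₁ j : K₀)))) K₀ := by
    have hval : (fun i => ((Sum.elim x₁ (fun j => (y₁ j : K₀)) i : K₀) : K)) =
        fun i => (Sum.elim x (fun j => (y j : K)) i) ^ p := by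
      funext i
      rcases i with i | j <;> rfl
    haveI := hBp.isAlgebraic_field
    refine ⟨fun w => isAlgebraic_adjoin_of_coe K₀ _ ?_⟩
    rw [hval]
    exact Algebra.IsAlgebraic.isAlgebraic (w : K)
  exact transcendenceDefect_eq_zero_of_isAlgebraic O' hk₀ x₁ y₁ hx0₁ hx₁ hy₁ hgen

/-! ### The helper -/

/-- **Along an Abhyankar place the base field `K₀ = Frac A₀` of an `α_p`-torsor is defectless in
`K`.** For `k` of characteristic `p`, `O` a valuation ring of `K ⊇ k` which is an Abhyankar
place of `K/k`, `A₀ ⊆ O` finitely generated, `t ^ p ∈ A₀`, `Frac (A₀[t]) = K`: the valued field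
`(k(A₀), O ∩ k(A₀))` is defectless in the finite extension `K` — it is a finitely generated
valued function field without transcendence defect over the trivially valued `k`
(`transcendenceDefect_comap_eq_zero_of_pow_mem`, as `K^p ⊆ k(A₀)`), hence a defectless field by
Kuhlmann's generalized stability theorem (`Kuhlmann2010Stability_holds`).
[cite: Kuhlmann2010, Thm. 1.1] -/
theorem isDefectlessIn_torsor_of_isAbhyankarPlace :
    ∀ p : ℕ, p.Prime → ∀ (k K : Type) [Field k] [CharP k p] [Field K] [Algebra k K] (O : ValuationSubring K) (A₀ : Subalgebra k K) (h₀ : A₀.toSubring ≤ O.toSubring) (t : K), A₀.FG → t ^ p ∈ A₀ → IsFractionRing (Algebra.adjoin k (insert t (A₀ : Set K))) K → Literature.AlgebraicGeometry.Resolution.IsAbhyankarPlace O (algebraMap k K).fieldRange ⊤ → Literature.AlgebraicGeometry.Resolution.IsDefectlessIn (IntermediateField.adjoin k (A₀ : Set K)) (O.comap (algebraMap (IntermediateField.adjoin k (A₀ : Set K)) K)) K := by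
  intro p hp k K _ _ _ _ O A₀ h₀ t hfg htp hfr hA
  haveI : CharP K p := charP_of_injective_algebraMap (algebraMap k K).injective p
  set K₀ := IntermediateField.adjoin k (A₀ : Set K) with hK₀
  have hk : ∀ c : k, algebraMap k K c ∈ O := fun c => h₀ (A₀.algebraMap_mem c)
  have hk₀ : ∀ c : k, algebraMap k K₀ c ∈ O.comap (algebraMap K₀ K) := fun c => by
    rw [ValuationSubring.mem_comap, ← IsScalarTower.algebraMap_apply]
    exact hk c
  have hKp : ∀ z : K, z ^ p ∈ K₀ := torsor_pow_mem_adjoin hp A₀ t htp hfr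
  have hD : transcendenceDefect k (O.comap (algebraMap K₀ K)) hk₀ = 0 :=
    transcendenceDefect_comap_eq_zero_of_pow_mem O hk hp.pos K₀ hKp hk₀ hA
  have hdf : IsDefectlessField K₀ (O.comap (algebraMap K₀ K)) :=
    Kuhlmann2010Stability_holds k K₀ (fg_top_adjoin_of_fg A₀ hfg) _ hk₀ hD
  haveI := torsor_finiteDimensional_adjoin hp.pos A₀ t htp hfr
  exact hdf K inferInstance

end Summit.ResolutionOfSingularities.ResolutionOfSingularities.Theorems.PfaffLine
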